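import Summits.HodgeConjecture.HodgeConjecture.Theorems.PadicSemiregularLiftFormalLiftingFromClassLiftingPicKernelLift
import Summits.HodgeConjecture.HodgeConjecture.Theorems.PadicSemiregularLiftFormalLiftingFromClassLiftingRankOneStepClassLifting
import Summits.HodgeConjecture.HodgeConjecture.Theorems.PadicSemiregularLiftFormalLiftingFromClassLiftingGlue
import HarnessLib

/-!
# `FormalLiftingFromClassLifting` (stmt-HodgeConjecture-13825) · the RANK-ONE case, unconditionally

Composition of the landed pieces of the weight-one line of the crux P1a (`IdeatorFiveSketch`, lead
`prover-line-stmt-HodgeConjecture-13825-c1-0`) with the rank-one step of seat 2: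

* the WEIGHT-ONE ENGINE `WeightOne.detClass_extends` (c1-0, p112265): on `𝒳/W(k)` flat and
  separated with `p ≠ 2` and `H²(𝒳, 𝒪)[p] = 0`, for `E₁` finite locally free on `X_k` with a
  rationally pro-liftable class, the determinant class `det[F] ∈ Ȟ¹(X_{n+1}, 𝒪^×)` of EVERY finite-level
  finite locally free lift `F` of `E₁` extends to `X_{n+2}`;
* S6 IN RANK ONE `WeightOne.exists_lineBundle_pullback_iso_of_detClass_extends` /
  `stepClassLifting_of_detClass_extends_of_hasRank_one` (seat 2, p105672): a rank-one `F` whose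
  determinant class extends is itself the restriction of a line bundle, so `[F]` extends;
* the CLIMB `Glue.liftsFormally_of_stepClassLifting` (p76799).

Result: **for a LINE BUNDLE `E₁` (`HasRank E₁ 1`) the crux holds outright** — indeed with hypothesis
(⋆) and every torsion hypothesis except `H²(𝒳, 𝒪)[p] = 0` dropped (`liftsFormally_of_hasRank_one`),
which is precisely the repaired form of the original P1 in rank one (stmt-HodgeConjecture-1498 was
refuted in rank one by a Godeaux–Serre witness with `H²(𝒳, 𝒪)[p] ≠ 0`).

* `liftsFormally_of_hasRank_one` — smooth proper model, `p ≠ 2`, `H²(𝒳, 𝒪)[p] = 0`, `E₁` of rank `1`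
  with a rational pro-class ⇒ `E₁` lifts formally;
* `formalLiftingFromClassLifting_of_hasRank_one` — the crux's literal signature with `HasRank E₁ 1`
  inserted (the registered sub-goal of stmt-HodgeConjecture-13825 this file serves).
-/

noncomputable section

open CategoryTheory AlgebraicGeometry TopologicalSpace
open Literature.AlgebraicGeometry Literature.AlgebraicGeometry.Motives
  Literature.AlgebraicGeometry.Motives.WittScheme Literature.AlgebraicGeometry.Modules
  Literature.AlgebraicGeometry.KTheory

-- the mandated namespace `Summit.HodgeConjecture.HodgeConjecture.…` repeats a component
set_option linter.dupNamespace false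

namespace Summit.HodgeConjecture.HodgeConjecture.Theorems.FormalLiftingFromClassLifting.RankOne

open Summit.HodgeConjecture.HodgeConjecture.Theorems.FormalLiftingFromClassLifting.WeightOne
  (detClass_extends exists_lineBundle_pullback_iso_of_detClass_extends
    stepClassLifting_of_detClass_extends_of_hasRank_one hasRank_of_pullback_specialFibreToThickening_iso)
open Summit.HodgeConjecture.HodgeConjecture.Theorems.FormalLiftingFromClassLifting.Glue
  (liftsFormally_of_stepClassLifting)

variable {p : ℕ} [Fact p.Prime] {k : Type} [Field k] [CharP k p] [PerfectRing k p] {d : ℕ}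
  {𝒳 : SchemeOver (WittVector p k)}

/-- **Line bundles with a rational pro-class lift formally.** On a smooth proper model `𝒳/W(k)` with
`p ≠ 2` and `H²(𝒳, 𝒪)[p] = 0`, a finite locally free `E₁` of rank `1` on the special fibre whose
rational `K₀`-class lifts to a continuous pro-class lifts to a compatible system of vector bundles on
all thickenings: at each level the determinant class of the current lift extends (weight-one engine
`detClass_extends`), hence — the lift being a line bundle — the lift itself extends
(`exists_lineBundle_pullback_iso_of_detClass_extends`), and the climb
`Glue.liftsFormally_of_stepClassLifting` assembles the tower. [folklore] -/
theorem liftsFormally_of_hasRank_one (h𝒳 : IsSmoothProperModel d 𝒳) (hp : p ≠ 2)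
    (hO : ∀ x : structureSheafCohomology 𝒳.left 2, (p : ℤ) • x = 0 → x = 0)
    {E₁ : (specialFibre 𝒳).left.Modules} (hE₁ : IsFiniteLocallyFree E₁) (h1 : HasRank E₁ 1)
    (hξ : ∃ ξ : KTheory.ContinuousKZeroRat (Ideal.span {(p : WittVector p k)}) 𝒳,
      KTheory.KZeroRat.map (Crystalline.specialFibreToTower 𝒳)
        (KTheory.ContinuousKZeroRat.specialFibre (Ideal.span {(p : WittVector p k)}) 𝒳 ξ) =
        KTheory.KZeroRat.of E₁ hE₁) :
    LiftsFormally 𝒳 E₁ := by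
  haveI := h𝒳.smoothOfRelativeDimension
  haveI : Smooth 𝒳.hom := SmoothOfRelativeDimension.smooth d 𝒳.hom
  haveI : IsProper 𝒳.hom := h𝒳.isProper
  -- the determinant class of every finite-level lift extends (weight-one engine)
  have hdet : ∀ (n : ℕ) (F : (thickening 𝒳 (n + 1)).left.Modules) (hF : IsFiniteLocallyFree F),
      Nonempty ((Scheme.Modules.pullback (specialFibreToThickening 𝒳 n)).obj F ≅ E₁) →
      ∃ c' : CechPic (thickening 𝒳 (n + 2)).left,
        CechPic.pullback (thickeningMap 𝒳 (Nat.le_succ (n + 1))) c' = detClass hF :=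
    detClass_extends p k 𝒳 hp hO E₁ hE₁ hξ
  -- every finite-level lift of the line bundle `E₁` is a line bundle
  have hrk : ∀ (n : ℕ) (F : (thickening 𝒳 (n + 1)).left.Modules) (hF : IsFiniteLocallyFree F),
      Nonempty ((Scheme.Modules.pullback (specialFibreToThickening 𝒳 n)).obj F ≅ E₁) → HasRank F 1 :=
    fun n F hF ⟨e⟩ => hasRank_of_pullback_specialFibreToThickening_iso 𝒳 n hF h1 e
  refine liftsFormally_of_stepClassLifting hE₁ (fun n F hF hFE _ => ?_) (fun n F hF hFE => ?_)
  · obtain ⟨L', -, hL', hiso⟩ := exists_lineBundle_pullback_iso_of_detClass_extends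
      (thickeningMap 𝒳 (Nat.le_succ (n + 1))) hF (hrk n F hF hFE) (hdet n F hF hFE)
    exact ⟨L', hL', hiso⟩
  · exact stepClassLifting_of_detClass_extends_of_hasRank_one _ _
      (thickeningMap 𝒳 (Nat.le_succ (n + 1))) F hF (hrk n F hF hFE) (hdet n F hF hFE)

/-- **The crux `FormalLiftingFromClassLifting` (stmt-HodgeConjecture-13825) for LINE BUNDLES** — its
literal signature with the extra hypothesis `HasRank E₁ 1`, unconditionally (`p ≠ 2` from `d + 6 < p`;
`H²(𝒳, 𝒪)[p] = 0` is the `b = 2` instance of the crux's torsion hypothesis; (⋆), projectivity and the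
other torsion hypotheses are not needed in rank one). [folklore] -/
theorem formalLiftingFromClassLifting_of_hasRank_one :
    ∀ (p : ℕ) [Fact p.Prime] (k : Type) [Field k] [CharP k p] [PerfectRing k p] (d : ℕ)
      (𝒳 : SchemeOver (WittVector p k)), IsSmoothProperModel d 𝒳 →
      Literature.AlgebraicGeometry.Crystalline.IsProjectiveOverRing 𝒳 → d + 6 < p →
      (∀ (b : ℕ) (x : structureSheafCohomology 𝒳.left b), (p : ℤ) • x = 0 → x = 0) →
      (∀ (b : ℕ) (x : hodgeCohomologyOne 𝒳 b), (p : ℤ) • x = 0 → x = 0) →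
      (d ≤ 3 ∨ Nonempty (cotangentSheaf 𝒳 ≅ SheafOfModules.free (R := 𝒳.left.ringCatSheaf) (Fin d))) →
      ∀ (E₁ : (specialFibre 𝒳).left.Modules) (hE₁ : IsFiniteLocallyFree E₁), HasRank E₁ 1 →
        (∀ (n : ℕ) (F : (thickening 𝒳 (n + 1)).left.Modules) (hF : IsFiniteLocallyFree F),
          Nonempty ((Scheme.Modules.pullback (specialFibreToThickening 𝒳 n)).obj F ≅ E₁) →
          (∃ y : KTheory.KZero (thickening 𝒳 (n + 2)).left,
            KTheory.KZero.map (thickeningMap 𝒳 (Nat.le_succ (n + 1))) y = KTheory.KZero.of F hF) →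
          ∃ F' : (thickening 𝒳 (n + 2)).left.Modules, IsFiniteLocallyFree F' ∧
            Nonempty ((Scheme.Modules.pullback (thickeningMap 𝒳 (Nat.le_succ (n + 1)))).obj F' ≅ F)) →
        (∃ ξ : KTheory.ContinuousKZeroRat (Ideal.span {(p : WittVector p k)}) 𝒳,
          KTheory.KZeroRat.map (Literature.AlgebraicGeometry.Crystalline.specialFibreToTower 𝒳)
            (KTheory.ContinuousKZeroRat.specialFibre (Ideal.span {(p : WittVector p k)}) 𝒳 ξ) =
            KTheory.KZeroRat.of E₁ hE₁) →
        LiftsFormally 𝒳 E₁ := by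
  intro p _ k _ _ _ d 𝒳 h𝒳 _ hdp hO _ _ E₁ hE₁ h1 _ hξ
  have hp : p ≠ 2 := by omega
  exact liftsFormally_of_hasRank_one h𝒳 hp (hO 2) hE₁ h1 hξ

end Summit.HodgeConjecture.HodgeConjecture.Theorems.FormalLiftingFromClassLifting.RankOne

end
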